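import Mathlib.Algebra.Module.Torsion.Basic
import Mathlib.RingTheory.Noetherian.Basic
import Mathlib.LinearAlgebra.Quotient.Basic
import Mathlib.Algebra.Module.Submodule.Pointwise
import HarnessLib

/-!
# Lifting cocycles modulo `π^{n+1}` to genuine cocycles, up to `π^{n+1-e}`, when `H¹` has bounded `π`-torsion

The algebra behind the surjectivity half of the theorem on formal functions in degree `0` over a
discrete valuation ring (Grothendieck, EGA III₁, Thm. 4.1.5; Hartshorne, *Algebraic Geometry*, III,
Thm. 11.1; Stacks Project, Tag 02OC), isolated as a statement about three modules
`C⁰ →ᵈ C¹ →ᵈ' C²` over a commutative ring `R` with `d' ∘ d = 0`, an element `π ∈ R` which is a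
non-zero-divisor on `C²`, and an exponent `e` killing the `π`-primary torsion of
`H¹ = Ker d' / Im d`:

* `exists_mem_ker_sub_eq_smul` — **lifting lemma**: if `z ∈ C⁰` is a cocycle modulo `π^{n+1}`
  (`d z ∈ π^{n+1} C¹`) and `e ≤ n + 1`, there is a genuine cocycle `c ∈ Ker d` with
  `c ≡ z (mod π^{n+1-e} C⁰)`. Proof: `d z = π^{n+1} y` with `d' y = 0`; the class of `y` is
  `π^{n+1}`-torsion, so `π^e y = d w`, and `c = z - π^{n+1-e} w` works. (This is the connecting
  homomorphism `H⁰(C/π^{n+1}) → H¹(C)[π^{n+1}]` of `0 → C →^{π^{n+1}} C → C/π^{n+1} → 0` made explicit: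
  `δ_{n-e}(z mod π^{n+1-e}) = π^e δ_n(z) = 0`.)
* `exists_pow_smul_eq_zero_of_isNoetherian` — over any ring, a Noetherian module has **bounded
  `π`-power torsion**: there is `e` with `π^e m = 0` whenever some power of `π` kills `m` (the chain
  `M[π] ⊆ M[π²] ⊆ ⋯` is stationary); `exists_torsionBound_of_isNoetherian_quotient` — the form used
  above, for `H¹ = Ker d' / Im d` Noetherian (e.g. finitely generated over a Noetherian ring).

Everything is proved; used in this tree to lift trivialisations of a line bundle from the
infinitesimal neighbourhoods of the closed fibre of a projective scheme over a DVR (finiteness of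
`Ȟ¹` by Serre's theorem) to the whole scheme. Mathlib searched (pin): `Submodule.torsionBy`,
`IsNoetherian`/`monotone_stabilizes_iff_noetherian`, `LinearMap.range`, `LinearMap.ker` (used);
Mathlib has no theorem on formal functions.

## References

* A. Grothendieck, *EGA III₁*, Publ. Math. IHÉS 11 (1961): Thm. 4.1.5 and its proof (Artin–Rees /
  Mittag-Leffler on `Hⁱ`).
* R. Hartshorne, *Algebraic Geometry*, GTM 52 (1977): III Thm. 11.1 and its proof. [Hartshorne1977]
* The Stacks Project, Tag 02OC (Cohomology of Schemes, Thm. 30.20.5). [StacksProject]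
-/

universe u v

namespace Literature.Algebra.Homology

open LinearMap
open scoped Pointwise

variable {R : Type u} [CommRing R]

section Lifting

variable {C₀ : Type v} {C₁ : Type v} {C₂ : Type v} [AddCommGroup C₀] [Module R C₀]
  [AddCommGroup C₁] [Module R C₁] [AddCommGroup C₂] [Module R C₂]
  (d : C₀ →ₗ[R] C₁) (d' : C₁ →ₗ[R] C₂)

/-- **Lifting lemma.** Let `C⁰ →ᵈ C¹ →ᵈ' C²` be `R`-linear with `d' ∘ d = 0`, let `π ∈ R` be a
non-zero-divisor on `C²`, and let `e` be an exponent such that every element of `Ker d'`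
some `π`-power multiple of which is a boundary already has its `π^e`-multiple a boundary (bounded
`π`-torsion of `H¹ = Ker d'/Im d`). If `z ∈ C⁰` satisfies `d z = π^{n+1} y` for some `y` and
`e ≤ n + 1`, then there is `c ∈ Ker d` with `c - z ∈ π^{n+1-e} C⁰`. [folklore] -/
theorem exists_mem_ker_sub_eq_smul (hdd : ∀ x, d' (d x) = 0) (π : R)
    (hπ₂ : ∀ y : C₂, π • y = 0 → y = 0) (e : ℕ)
    (htor : ∀ y : C₁, d' y = 0 → (∃ k : ℕ, π ^ k • y ∈ range d) → π ^ e • y ∈ range d)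
    {n : ℕ} (hen : e ≤ n + 1) {z : C₀} {y : C₁} (hz : d z = π ^ (n + 1) • y) :
    ∃ c : C₀, d c = 0 ∧ ∃ w : C₀, c - z = π ^ (n + 1 - e) • w := by
  -- `π` and its powers are non-zero-divisors on `C₂`
  have hπ₂pow : ∀ (k : ℕ) (x : C₂), π ^ k • x = 0 → x = 0 := by
    intro k
    induction k with
    | zero => intro x hx; simpa using hx
    | succ k ih =>
      intro x hx
      rw [pow_succ, mul_smul] at hx
      exact hπ₂ x (ih _ hx)
  -- `d' y = 0`
  have hy : d' y = 0 := by
    apply hπ₂pow (n + 1)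
    rw [← LinearMap.map_smul, ← hz, hdd]
  -- the class of `y` is `π^{n+1}`-torsion, hence `π^e y = d w`
  obtain ⟨w, hw⟩ : π ^ e • y ∈ range d := htor y hy ⟨n + 1, ⟨z, hz⟩⟩
  refine ⟨z - π ^ (n + 1 - e) • w, ?_, -w, ?_⟩
  · rw [map_sub, LinearMap.map_smul, hw, ← mul_smul, ← pow_add, Nat.sub_add_cancel hen, hz, sub_self]
  · rw [smul_neg]; abel

/-- Variant with the conclusion as a congruence: `c ≡ z` modulo `π^{n+1-e} C⁰`. [folklore] -/
theorem exists_mem_ker_sub_mem_smul_top (hdd : ∀ x, d' (d x) = 0) (π : R)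
    (hπ₂ : ∀ y : C₂, π • y = 0 → y = 0) (e : ℕ)
    (htor : ∀ y : C₁, d' y = 0 → (∃ k : ℕ, π ^ k • y ∈ range d) → π ^ e • y ∈ range d)
    {n : ℕ} (hen : e ≤ n + 1) {z : C₀} (hz : d z ∈ π ^ (n + 1) • (⊤ : Submodule R C₁)) :
    ∃ c ∈ ker d, c - z ∈ π ^ (n + 1 - e) • (⊤ : Submodule R C₀) := by
  obtain ⟨y, -, hy⟩ := (Submodule.mem_smul_pointwise_iff_exists _ _ _).mp hz
  obtain ⟨c, hc, w, hw⟩ := exists_mem_ker_sub_eq_smul d d' hdd π hπ₂ e htor hen hy.symm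
  exact ⟨c, hc, (Submodule.mem_smul_pointwise_iff_exists _ _ _).mpr ⟨w, Submodule.mem_top, hw.symm⟩⟩

end Lifting

/-! ### Bounded `π`-power torsion of Noetherian modules -/

section Torsion

variable {M : Type v} [AddCommGroup M] [Module R M]

/-- **A Noetherian module has bounded `π`-power torsion**: there is `e` such that `π^e m = 0` for
every `m` killed by some power of `π` (the submodules `{m | π^k m = 0}` form an increasing chain).
[folklore] -/
theorem exists_pow_smul_eq_zero_of_isNoetherian [IsNoetherian R M] (π : R) :
    ∃ e : ℕ, ∀ m : M, (∃ k : ℕ, π ^ k • m = 0) → π ^ e • m = 0 := by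
  let f : ℕ →o Submodule R M :=
    ⟨fun k => Submodule.torsionBy R M (π ^ k), fun k l hkl m hm => by
      rw [Submodule.mem_torsionBy_iff] at hm ⊢
      obtain ⟨c, rfl⟩ := Nat.exists_eq_add_of_le hkl
      rw [add_comm, pow_add, mul_smul, hm, smul_zero]⟩
  obtain ⟨e, he⟩ := monotone_stabilizes_iff_noetherian.mpr (inferInstance : IsNoetherian R M) f
  refine ⟨e, fun m ⟨k, hk⟩ => ?_⟩
  have hk'' : m ∈ Submodule.torsionBy R M (π ^ max e k) := by
    rw [Submodule.mem_torsionBy_iff]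
    obtain ⟨c, hc⟩ := Nat.exists_eq_add_of_le (le_max_right e k)
    rw [hc, add_comm, pow_add, mul_smul, hk, smul_zero]
  have hk' : m ∈ f (max e k) := hk''
  rw [← he (max e k) (le_max_left e k)] at hk'
  have hk3 : m ∈ Submodule.torsionBy R M (π ^ e) := hk'
  exact (Submodule.mem_torsionBy_iff _ _).mp hk3

variable {C₀ : Type v} {C₁ : Type v} {C₂ : Type v} [AddCommGroup C₀] [Module R C₀]
  [AddCommGroup C₁] [Module R C₁] [AddCommGroup C₂] [Module R C₂]
  (d : C₀ →ₗ[R] C₁) (d' : C₁ →ₗ[R] C₂)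

/-- **Bounded torsion of `H¹ = Ker d'/Im d`** in the form used by the lifting lemma: if the quotient
of `Ker d'` by (the preimage of) `Im d` is a Noetherian `R`-module, there is `e` such that for every
`y ∈ Ker d'` with `π^k y ∈ Im d` for some `k` already `π^e y ∈ Im d`. [folklore] -/
theorem exists_torsionBound_of_isNoetherian_quotient (π : R)
    [IsNoetherian R (ker d' ⧸ (range d).comap (ker d').subtype)] :
    ∃ e : ℕ, ∀ y : C₁, d' y = 0 → (∃ k : ℕ, π ^ k • y ∈ range d) → π ^ e • y ∈ range d := by
  obtain ⟨e, he⟩ := exists_pow_smul_eq_zero_of_isNoetherian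
    (M := ker d' ⧸ (range d).comap (ker d').subtype) π
  refine ⟨e, fun y hy ⟨k, hk⟩ => ?_⟩
  have h := he (Submodule.Quotient.mk ⟨y, hy⟩) ⟨k, ?_⟩
  · rw [← Submodule.Quotient.mk_smul, Submodule.Quotient.mk_eq_zero] at h
    exact h
  · rw [← Submodule.Quotient.mk_smul, Submodule.Quotient.mk_eq_zero]
    exact hk

end Torsion

end Literature.Algebra.Homology
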